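import Summits.CriticalPhenomena.Ising3DConformalLimit.Theorems.PerfectScreeningCoulombImpliesNontrivialIsothermOfOneArm
import Summits.CriticalPhenomena.Ising3DConformalLimit.Theses.ArmHyperscaling
import Literature.Probability.LatticeModels.HighDimPointwiseTriviality
import HarnessLib

/-!
# Strategist note (evidence only): in the Coulomb world, item 15591 ⟺ the SketchPub one-arm entrance

Companion of `StrategistPayers.lean` (crux-strategist planner-cstrat-stmt-CriticalPhenomena-13885-s1-0,
2026-08-17). `StrategistPayers.lean` proves item 15591 (`ArmHyperscaling.OneArmHyperscaling`) ⟹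
`⟨σ₀⟩⁺_{box L} ≤ C L^{-1/2}` ⟹ crux 13885. This file records the converse direction UNDER the
crux's own antecedent (Coulomb lower bound): `⟨σ₀⟩⁺_{box L} ≤ C L^{-1/2}` ∧ Coulomb ⟹ 15591 (K = 1).
Hence, inside the Coulomb branch, "FK gluing / one-arm hyperscaling (15591)" is not a new lever for
r3 but the SketchPub residual's entrance in FK dress (census, Transfer T3). Deliberately a
conditional theorem (audit class proof.conditional); not meant for `Theorems/`.
-/

noncomputable section

namespace Summit.CriticalPhenomena.Ising3DConformalLimit.PerfectScreeningCoulombImpliesNontrivial.StrategistNote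

open Literature.Probability.LatticeModels Filter Set Finset
open scoped Topology BigOperators

/-- `‖2n·e₀‖_∞ = 2n` on `Site 3`. [folklore] -/
theorem norm_single_two_mul' (n : ℕ) : ‖(Pi.single 0 (2 * (n : ℤ)) : Site 3)‖ = 2 * n := by
  rw [Pi.norm_single, Int.norm_eq_abs]
  push_cast
  rw [abs_of_nonneg (by positivity)]

/-- `2n·e₀ ≠ 0` for `n ≥ 1`. [folklore] -/
theorem single_two_mul_ne_zero' {n : ℕ} (hn : 1 ≤ n) : (Pi.single 0 (2 * (n : ℤ)) : Site 3) ≠ 0 := by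
  intro h
  have := congrFun h 0
  simp at this
  omega

/-- **Converse under the Coulomb antecedent**: the one-arm form of `stub_isothermOfOneArm` and the
Coulomb lower bound `c/‖x‖ ≤ ⟨σ₀σ_x⟩_{β_c}` give item 15591 back (with `K = 1`). So IN THE COULOMB
WORLD item 15591 (FK-gluing form of one-arm hyperscaling) and the SketchPub residual's sufficient
entrance "`⟨σ₀⟩⁺_{box L} ≤ C L^{-1/2}`" are the SAME statement — recorded for the census (Transfer T3:
the 3D one-arm/gluing bound is the residual in FK dress, not a new lever). [folklore] -/
theorem oneArmHyperscaling_of_oneArmSqrtBound_of_coulomb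
    (hC : ∃ c : ℝ, 0 < c ∧ ∀ x : Site 3, x ≠ 0 → c / ‖x‖ ≤ criticalTwoPoint 3 x)
    (h1 : ∃ C : ℝ, ∀ L : ℕ, 1 ≤ L →
      isingExpect (zdGraph 3) (box 3 L) (criticalBeta 3) 0 .plus (spinAt 0) ≤ C * (L : ℝ) ^ (-(1:ℝ) / 2)) :
    Summit.CriticalPhenomena.Ising3DConformalLimit.Theses.ArmHyperscaling.OneArmHyperscaling := by
  obtain ⟨c, hc, hlow⟩ := hC
  obtain ⟨C, hCub⟩ := h1
  refine ⟨1, le_rfl, 2 * C ^ 2 / c, fun n hn => ?_⟩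
  have hnpos : (0 : ℝ) < n := by exact_mod_cast hn
  have hrpow : ((1 * n : ℕ) : ℝ) ^ (-(1:ℝ) / 2) = (Real.sqrt n)⁻¹ := by
    rw [one_mul, show (-(1:ℝ) / 2) = -((1:ℝ) / 2) by ring, Real.rpow_neg hnpos.le, ← Real.sqrt_eq_rpow]
  have ha := hCub (1 * n) (by omega)
  rw [hrpow] at ha
  set a : ℝ := isingExpect (zdGraph 3) (box 3 (1 * n)) (criticalBeta 3) 0 .plus (spinAt 0) with hadef
  have ha0 : 0 ≤ a := by
    -- GKS I for the plus box state
    have := GKSInequalities.gks_one_holds (zdGraph 3) (Λ := box 3 (1 * n)) (A := ({0} : Finset (Site 3)))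
      (β := criticalBeta 3) (h := 0) (bc := .plus) (criticalBeta_pos_holds (d := 3) (by norm_num)).le
      le_rfl (Or.inr rfl) (Finset.singleton_subset_iff.2 (zero_mem_box 3 (1 * n)))
    simpa [hadef, isingCorr] using this
  have hCpos : 0 ≤ C := by
    by_contra hneg
    push Not at hneg
    have : a < 0 := ha.trans_lt (mul_neg_of_neg_of_pos hneg (inv_pos.2 (Real.sqrt_pos.2 hnpos)))
    linarith
  -- `a² ≤ C²/n`
  have hsq : a ^ 2 ≤ C ^ 2 / n := by
    have h2 : a ^ 2 ≤ (C * (Real.sqrt n)⁻¹) ^ 2 := pow_le_pow_left₀ ha0 ha 2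
    calc a ^ 2 ≤ (C * (Real.sqrt n)⁻¹) ^ 2 := h2
      _ = C ^ 2 / n := by
          rw [mul_pow, inv_pow, Real.sq_sqrt hnpos.le, div_eq_mul_inv]
  -- Coulomb: `c/(2n) ≤ G(2n e₀)`
  have hG : c / (2 * n) ≤ criticalTwoPoint 3 (Pi.single 0 (2 * (n : ℤ))) := by
    have := hlow _ (single_two_mul_ne_zero' hn)
    rwa [norm_single_two_mul'] at this
  have hisingCorr : isingCorr (zdGraph 3) (box 3 (1 * n)) (criticalBeta 3) 0 .plus {0} = a := by
    simp [hadef, isingCorr]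
  rw [hisingCorr]
  calc a ^ 2 ≤ C ^ 2 / n := hsq
    _ = 2 * C ^ 2 / c * (c / (2 * n)) := by field_simp
    _ ≤ 2 * C ^ 2 / c * criticalTwoPoint 3 (Pi.single 0 (2 * (n : ℤ))) :=
        mul_le_mul_of_nonneg_left hG (by positivity)


end Summit.CriticalPhenomena.Ising3DConformalLimit.PerfectScreeningCoulombImpliesNontrivial.StrategistNote

end
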